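import Mathlib
import Summits.NavierStokesRegularity.NavierStokesRegularity.Theorems.FilamentSkeletonRssSelectionBoxRJRungPartnerClose

/-!
# Route `FilamentSkeletonRss` · crux `SelectionBoxRJ` (stmt-NavierStokesRegularity-21220) — rung tools (R2, brick 4c):
# the frozen true-partner forcing is Lipschitz in the tangent field (`≤ 36 δ √Γ`)

Lane `ns-filament-19175-p1` (g7); helper file `--supports stmt-NavierStokesRegularity-21220`, route-independent.

For the contraction of the nonlocal rung's Picard map: if `z₁, z₂` are `C¹` unit-speed curves through the waist point `P`
with `‖zᵢ′ − e‖ ≤ θ ≤ 1/500` and `‖z₁′ − z₂′‖ ≤ δ` on `ℝ`, then the true partner forcings (regularised Biot–Savart field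
of `R_π ∘ zᵢ` at the moving point `zᵢ t`, circulation factor `Γ·4/(4π)`) satisfy
`‖f₁ t − f₂ t‖ ≤ 36 δ √Γ` for every `t` (`partnerForcing_lipschitz`).  Two pieces: the change of the partner CURVE seen from
`z₁ t` (g6's `biotSavart_curveLipschitz`, pivot form with `θ := δ`; contributes `≤ (51/2)δ√Γ`) and the change of the
EVALUATION POINT for the field of `R_π ∘ z₂` (mean value inequality on the segment `[z₂ t, z₁ t]` with g6's gradient bound
`biotSavart_fderiv_norm_le`; contributes `≤ (21/2)δ√Γ` thanks to the `1/dist²` decay).  Auxiliary: `curves_sub_le`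
(`‖z₁ u − z₂ u‖ ≤ δ|u|`), `nearStraight_sep_rot₂` (a near-straight curve versus the `R_π`-image of ANOTHER one).

HONEST FRAMING.  Kernel bookkeeping for the rung ladder of a HYPOTHETICAL filament box; nothing here is a claim about
Navier–Stokes regularity or blow-up.
-/

set_option linter.dupNamespace false -- `Theorems.…Theorems`-style path/namespace repetition is the tree convention

noncomputable section

namespace Summit.NavierStokesRegularity.NavierStokesRegularity.Theorems

open Set Function Filter MeasureTheory Real
open Literature.Analysis.FluidPDE
open Summit.NavierStokesRegularity.NavierStokesRegularity.Theorems.SkeletonEquilibrium.Sketch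
open scoped InnerProductSpace Topology

namespace SelectionBoxRJRung

/-- Two differentiable curves with the same starting point and tangents within `δ` stay within `δ|u|`. [folklore] -/
theorem curves_sub_le {δ : ℝ} {z₁ z₂ : ℝ → EuclideanSpace ℝ (Fin 3)} (h₁ : Differentiable ℝ z₁) (h₂ : Differentiable ℝ z₂)
    (h0 : z₁ 0 = z₂ 0) (hδ : ∀ u, ‖deriv z₁ u - deriv z₂ u‖ ≤ δ) (u : ℝ) : ‖z₁ u - z₂ u‖ ≤ δ * |u| := by
  have hd : ∀ v, HasDerivAt (fun s => z₁ s - z₂ s) (deriv z₁ v - deriv z₂ v) v := fun v =>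
    ((h₁ v).hasDerivAt).sub ((h₂ v).hasDerivAt)
  have h := Convex.norm_image_sub_le_of_norm_deriv_le (f := fun s => z₁ s - z₂ s)
    (fun v _ => (hd v).differentiableAt) (fun v _ => by rw [(hd v).deriv]; exact hδ v) convex_univ (mem_univ 0)
    (mem_univ u)
  simp only [h0, sub_self, sub_zero, Real.norm_eq_abs] at h
  exact h

/-- **A near-straight curve versus the `R_π`-image of another.**  If `z₁, z₂` are differentiable with `zᵢ 0 = P` and
`‖zᵢ′ − e‖ ≤ θ` (`0 ≤ θ ≤ 1/4`), then `‖z₁ τ − R_π z₂ σ‖ ≥ (1 − 2θ)·√(4Γ/25 + τ² + σ²)`; in particular it dominates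
`(1 − 2θ)(2/5)√Γ`, `(1 − 2θ)|σ|` and `(1 − 2θ)|τ|`. [folklore] -/
theorem nearStraight_sep_rot₂ {Γ θ : ℝ} (hΓ : 0 < Γ) (hθ0 : 0 ≤ θ) (hθ1 : θ ≤ 1 / 4)
    {z₁ z₂ : ℝ → EuclideanSpace ℝ (Fin 3)} (h₁ : Differentiable ℝ z₁) (h₂ : Differentiable ℝ z₂)
    (hz₁ : z₁ 0 = WithLp.toLp 2 ![Real.sqrt Γ / 5, 0, 0]) (hz₂ : z₂ 0 = WithLp.toLp 2 ![Real.sqrt Γ / 5, 0, 0])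
    (hθ₁ : ∀ s, ‖deriv z₁ s - WithLp.toLp 2 ![0, (Real.sqrt 2)⁻¹, (Real.sqrt 2)⁻¹]‖ ≤ θ)
    (hθ₂ : ∀ s, ‖deriv z₂ s - WithLp.toLp 2 ![0, (Real.sqrt 2)⁻¹, (Real.sqrt 2)⁻¹]‖ ≤ θ) (τ σ : ℝ) :
    (1 - 2 * θ) * Real.sqrt (4 * Γ / 25 + τ ^ 2 + σ ^ 2) ≤
        ‖z₁ τ - ((2 * ⟪z₂ σ, EuclideanSpace.single 2 1⟫_ℝ) • (EuclideanSpace.single (2 : Fin 3) (1 : ℝ)) - z₂ σ)‖ ∧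
      (1 - 2 * θ) * (2 * Real.sqrt Γ / 5) ≤
        ‖z₁ τ - ((2 * ⟪z₂ σ, EuclideanSpace.single 2 1⟫_ℝ) • (EuclideanSpace.single (2 : Fin 3) (1 : ℝ)) - z₂ σ)‖ ∧
      (1 - 2 * θ) * |σ| ≤
        ‖z₁ τ - ((2 * ⟪z₂ σ, EuclideanSpace.single 2 1⟫_ℝ) • (EuclideanSpace.single (2 : Fin 3) (1 : ℝ)) - z₂ σ)‖ ∧
      (1 - 2 * θ) * |τ| ≤
        ‖z₁ τ - ((2 * ⟪z₂ σ, EuclideanSpace.single 2 1⟫_ℝ) • (EuclideanSpace.single (2 : Fin 3) (1 : ℝ)) - z₂ σ)‖ := by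
  have hG : 0 < Real.sqrt Γ := Real.sqrt_pos.2 hΓ
  have hG2 : Real.sqrt Γ ^ 2 = Γ := Real.sq_sqrt hΓ.le
  have hdτ := arc_displacement_le h₁ hz₁ hθ₁ τ
  have hdσ := arc_displacement_le h₂ hz₂ hθ₂ σ
  have hN2 := norm_sq_line_sub_rot Γ τ σ hΓ.le
  obtain ⟨P, hP⟩ : ∃ P : EuclideanSpace ℝ (Fin 3), P = WithLp.toLp 2 ![Real.sqrt Γ / 5, 0, 0] := ⟨_, rfl⟩
  obtain ⟨e, he⟩ : ∃ e : EuclideanSpace ℝ (Fin 3), e = WithLp.toLp 2 ![0, (Real.sqrt 2)⁻¹, (Real.sqrt 2)⁻¹] := ⟨_, rfl⟩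
  obtain ⟨e₃, he₃⟩ : ∃ e₃ : EuclideanSpace ℝ (Fin 3), e₃ = EuclideanSpace.single (2 : Fin 3) (1 : ℝ) := ⟨_, rfl⟩
  rw [← hP, ← he] at hdτ hdσ hN2
  rw [← he₃] at hN2 ⊢
  have hN0 := norm_nonneg ((P + τ • e) - ((2 * ⟪P + σ • e, e₃⟫_ℝ) • e₃ - (P + σ • e)))
  have hNsqrt : ‖(P + τ • e) - ((2 * ⟪P + σ • e, e₃⟫_ℝ) • e₃ - (P + σ • e))‖ = Real.sqrt (4 * Γ / 25 + τ ^ 2 + σ ^ 2) := by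
    rw [← hN2, Real.sqrt_sq hN0]
  have hNG : 2 * Real.sqrt Γ / 5 ≤ ‖(P + τ • e) - ((2 * ⟪P + σ • e, e₃⟫_ℝ) • e₃ - (P + σ • e))‖ := by
    nlinarith [hN2, hG2, hG, sq_nonneg τ, sq_nonneg σ, hN0, mul_nonneg hN0 hG.le]
  have hNτ : |τ| ≤ ‖(P + τ • e) - ((2 * ⟪P + σ • e, e₃⟫_ℝ) • e₃ - (P + σ • e))‖ := by
    nlinarith [hN2, sq_abs τ, hΓ, sq_nonneg σ, abs_nonneg τ, hN0, mul_nonneg hN0 (abs_nonneg τ)]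
  have hNσ : |σ| ≤ ‖(P + τ • e) - ((2 * ⟪P + σ • e, e₃⟫_ℝ) • e₃ - (P + σ • e))‖ := by
    nlinarith [hN2, sq_abs σ, hΓ, sq_nonneg τ, abs_nonneg σ, hN0, mul_nonneg hN0 (abs_nonneg σ)]
  have hRlin : ∀ a b : EuclideanSpace ℝ (Fin 3),
      ((2 * ⟪a, e₃⟫_ℝ) • e₃ - a) - ((2 * ⟪b, e₃⟫_ℝ) • e₃ - b) = (2 * ⟪a - b, e₃⟫_ℝ) • e₃ - (a - b) := by
    intro a b; rw [inner_sub_left, mul_sub, sub_smul]; abel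
  have hdec : z₁ τ - ((2 * ⟪z₂ σ, e₃⟫_ℝ) • e₃ - z₂ σ) =
      ((P + τ • e) - ((2 * ⟪P + σ • e, e₃⟫_ℝ) • e₃ - (P + σ • e))) + (z₁ τ - (P + τ • e)) -
        ((2 * ⟪z₂ σ - (P + σ • e), e₃⟫_ℝ) • e₃ - (z₂ σ - (P + σ • e))) := by
    rw [← hRlin]; abel
  have hRn : ‖(2 * ⟪z₂ σ - (P + σ • e), e₃⟫_ℝ) • e₃ - (z₂ σ - (P + σ • e))‖ = ‖z₂ σ - (P + σ • e)‖ := by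
    rw [he₃]; exact norm_rotPi _
  have key : ∀ A B C : EuclideanSpace ℝ (Fin 3), ‖A‖ ≤ ‖A + B - C‖ + ‖B‖ + ‖C‖ := by
    intro A B C
    have e1 : A = (A + B - C) + (C - B) := by abel
    calc ‖A‖ = ‖(A + B - C) + (C - B)‖ := by rw [← e1]
      _ ≤ ‖A + B - C‖ + ‖C - B‖ := norm_add_le _ _
      _ ≤ ‖A + B - C‖ + (‖C‖ + ‖B‖) := by gcongr; exact norm_sub_le _ _
      _ = ‖A + B - C‖ + ‖B‖ + ‖C‖ := by ring
  have hk := key ((P + τ • e) - ((2 * ⟪P + σ • e, e₃⟫_ℝ) • e₃ - (P + σ • e))) (z₁ τ - (P + τ • e))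
    ((2 * ⟪z₂ σ - (P + σ • e), e₃⟫_ℝ) • e₃ - (z₂ σ - (P + σ • e)))
  rw [← hdec, hRn] at hk
  have h1 := mul_le_mul_of_nonneg_left hNτ hθ0
  have h2 := mul_le_mul_of_nonneg_left hNσ hθ0
  have hW : (1 - 2 * θ) * ‖(P + τ • e) - ((2 * ⟪P + σ • e, e₃⟫_ℝ) • e₃ - (P + σ • e))‖ ≤
      ‖z₁ τ - ((2 * ⟪z₂ σ, e₃⟫_ℝ) • e₃ - z₂ σ)‖ := by linarith
  have h12 : 0 ≤ 1 - 2 * θ := by linarith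
  exact ⟨by rw [← hNsqrt]; exact hW, (mul_le_mul_of_nonneg_left hNG h12).trans hW,
    (mul_le_mul_of_nonneg_left hNσ h12).trans hW, (mul_le_mul_of_nonneg_left hNτ h12).trans hW⟩

/-- Numeric bound for the curve-change term: `(Γ/π)·2πδD(cD + 4D)/(c²D³) ≤ (51/2)δ√Γ` (`c = 1 − 2θ`, `D = c(2/5)√Γ`,
`0 ≤ θ ≤ 1/500`, `0 ≤ δ`). [folklore] -/
theorem termA_bound' {Γ θ δ : ℝ} (hΓ : 0 < Γ) (hθ1 : θ ≤ 1 / 500) (hδ : 0 ≤ δ) :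
    Γ * 4 / (4 * Real.pi) * (2 * Real.pi * δ * ((1 - 2 * θ) * (2 * Real.sqrt Γ / 5)) *
      ((1 - 2 * θ) * ((1 - 2 * θ) * (2 * Real.sqrt Γ / 5)) + 4 * ((1 - 2 * θ) * (2 * Real.sqrt Γ / 5))) /
      ((1 - 2 * θ) ^ 2 * ((1 - 2 * θ) * (2 * Real.sqrt Γ / 5)) ^ 3)) ≤ 51 / 2 * δ * Real.sqrt Γ := by
  have hG : 0 < Real.sqrt Γ := Real.sqrt_pos.2 hΓ
  have hG2 : Real.sqrt Γ ^ 2 = Γ := Real.sq_sqrt hΓ.le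
  have hc : 0 < 1 - 2 * θ := by linarith
  have hc3 : 0 < (1 - 2 * θ) ^ 3 := pow_pos hc 3
  have heq : Γ * 4 / (4 * Real.pi) * (2 * Real.pi * δ * ((1 - 2 * θ) * (2 * Real.sqrt Γ / 5)) *
      ((1 - 2 * θ) * ((1 - 2 * θ) * (2 * Real.sqrt Γ / 5)) + 4 * ((1 - 2 * θ) * (2 * Real.sqrt Γ / 5))) /
      ((1 - 2 * θ) ^ 2 * ((1 - 2 * θ) * (2 * Real.sqrt Γ / 5)) ^ 3)) =
      5 * Real.sqrt Γ * δ * ((1 - 2 * θ) + 4) / (1 - 2 * θ) ^ 3 := by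
    have hcne : (1 - 2 * θ) ≠ 0 := hc.ne'
    have hπ : Real.pi ≠ 0 := Real.pi_pos.ne'
    generalize hGdef : Real.sqrt Γ = G at hG hG2 ⊢
    subst hG2
    have hG0 : G ≠ 0 := hG.ne'
    field_simp
  rw [heq, div_le_iff₀ hc3]
  have h096 : (249 / 250 : ℝ) ≤ 1 - 2 * θ := by linarith
  have hc3' : (249 / 250 : ℝ) ^ 3 ≤ (1 - 2 * θ) ^ 3 := pow_le_pow_left₀ (by norm_num) h096 3
  nlinarith [mul_nonneg hδ hG.le, hc3', mul_nonneg (mul_nonneg hδ hG.le) (sub_nonneg.2 hc3')]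

/-- Numeric bound for the point-change term: `(Γ/π)·(8π·D/(c D³))·(δ|t|) ≤ (21/2)δ√Γ` with `c = 1 − 4θ`,
`D = c·N₁`, `N₁² = 4Γ/25 + t²` (so `|t|/N₁² ≤ 5/(4√Γ)`), `0 ≤ θ ≤ 1/500`, `0 ≤ δ`. [folklore] -/
theorem termC_bound {Γ θ δ : ℝ} (hΓ : 0 < Γ) (hθ1 : θ ≤ 1 / 500) (hδ : 0 ≤ δ) (t : ℝ) {N : ℝ}
    (hN : N ^ 2 = 4 * Γ / 25 + t ^ 2) (hN0 : 0 ≤ N) :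
    Γ * 4 / (4 * Real.pi) * (8 * Real.pi * ((1 - 4 * θ) * N + 0) / ((1 - 4 * θ) * ((1 - 4 * θ) * N) ^ 3)) * (δ * |t|)
      ≤ 21 / 2 * δ * Real.sqrt Γ := by
  have hG : 0 < Real.sqrt Γ := Real.sqrt_pos.2 hΓ
  have hG2 : Real.sqrt Γ ^ 2 = Γ := Real.sq_sqrt hΓ.le
  have hNpos : 0 < N := by nlinarith [sq_nonneg t]
  have hc : 0 < 1 - 4 * θ := by linarith
  have heq : Γ * 4 / (4 * Real.pi) * (8 * Real.pi * ((1 - 4 * θ) * N + 0) / ((1 - 4 * θ) * ((1 - 4 * θ) * N) ^ 3)) *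
      (δ * |t|) = 8 * Γ * δ * |t| / ((1 - 4 * θ) ^ 3 * N ^ 2) := by
    have hπ : Real.pi ≠ 0 := Real.pi_pos.ne'
    have hcne : 1 - 4 * θ ≠ 0 := hc.ne'
    have hNne : N ≠ 0 := hNpos.ne'
    field_simp
    ring
  rw [heq, div_le_iff₀ (by positivity), hN]
  have hAM : 4 * Real.sqrt Γ * |t| / 5 ≤ 4 * Γ / 25 + t ^ 2 := by
    nlinarith [sq_nonneg (2 * Real.sqrt Γ / 5 - |t|), sq_abs t, hG2]
  have hAB : 4 * Γ * |t| / 5 ≤ Real.sqrt Γ * (4 * Γ / 25 + t ^ 2) := by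
    have := mul_le_mul_of_nonneg_left hAM hG.le
    have h' : Real.sqrt Γ * (4 * Real.sqrt Γ * |t| / 5) = 4 * Γ * |t| / 5 := by
      linear_combination (4 * |t| / 5) * hG2
    linarith [h']
  have hc3 : (123 / 125 : ℝ) ^ 3 ≤ (1 - 4 * θ) ^ 3 := pow_le_pow_left₀ (by norm_num) (by linarith) 3
  have hB0 : 0 ≤ 4 * Γ * |t| / 5 := by positivity
  have ha : (123 / 125 : ℝ) ^ 3 * (4 * Γ * |t| / 5) ≤ (1 - 4 * θ) ^ 3 * (Real.sqrt Γ * (4 * Γ / 25 + t ^ 2)) :=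
    mul_le_mul hc3 hAB hB0 (le_trans (by norm_num) hc3)
  nlinarith [mul_le_mul_of_nonneg_left ha hδ, mul_nonneg (mul_nonneg hδ hΓ.le) (abs_nonneg t)]


/-- **The frozen true-partner forcing is Lipschitz in the curve.**  Let `z₁, z₂` be `C¹` unit-speed curves with
`zᵢ 0 = P = (√Γ/5, 0, 0)`, `‖zᵢ′ − e‖ ≤ θ` (`0 ≤ θ ≤ 1/500`) and `‖z₁′ − z₂′‖ ≤ δ` on `ℝ`.  Then for every `t` the regularised
Biot–Savart fields of the partners `R_π ∘ z₁` at `z₁ t` and `R_π ∘ z₂` at `z₂ t` (times `Γ·4/(4π)`) differ by at most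
`36 δ √Γ`. [folklore] -/
theorem partnerForcing_lipschitz {Γ θ δ : ℝ} (hΓ : 0 < Γ) (hθ0 : 0 ≤ θ) (hθ1 : θ ≤ 1 / 500) (hδ : 0 ≤ δ)
    {z₁ z₂ : ℝ → EuclideanSpace ℝ (Fin 3)} (hz₁ : ContDiff ℝ 1 z₁) (hz₂ : ContDiff ℝ 1 z₂)
    (hunit₁ : ∀ u, ‖deriv z₁ u‖ = 1) (hunit₂ : ∀ u, ‖deriv z₂ u‖ = 1)
    (hz₁0 : z₁ 0 = WithLp.toLp 2 ![Real.sqrt Γ / 5, 0, 0]) (hz₂0 : z₂ 0 = WithLp.toLp 2 ![Real.sqrt Γ / 5, 0, 0])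
    (hθ₁ : ∀ s, ‖deriv z₁ s - WithLp.toLp 2 ![0, (Real.sqrt 2)⁻¹, (Real.sqrt 2)⁻¹]‖ ≤ θ)
    (hθ₂ : ∀ s, ‖deriv z₂ s - WithLp.toLp 2 ![0, (Real.sqrt 2)⁻¹, (Real.sqrt 2)⁻¹]‖ ≤ θ)
    (hδ₁₂ : ∀ u, ‖deriv z₁ u - deriv z₂ u‖ ≤ δ) (t : ℝ) :
    ‖(Γ * 4 / (4 * Real.pi)) • (∫ σ : ℝ,
        ((‖z₁ t - ((2 * ⟪z₁ σ, EuclideanSpace.single 2 1⟫_ℝ) • (EuclideanSpace.single (2 : Fin 3) (1 : ℝ)) - z₁ σ)‖ ^ 2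
            + 1) ^ (3 / 2 : ℝ))⁻¹ •
          cross (deriv (fun u => (2 * ⟪z₁ u, EuclideanSpace.single 2 1⟫_ℝ) •
              (EuclideanSpace.single (2 : Fin 3) (1 : ℝ)) - z₁ u) σ)
            (z₁ t - ((2 * ⟪z₁ σ, EuclideanSpace.single 2 1⟫_ℝ) • (EuclideanSpace.single (2 : Fin 3) (1 : ℝ)) - z₁ σ)))
      - (Γ * 4 / (4 * Real.pi)) • (∫ σ : ℝ,
        ((‖z₂ t - ((2 * ⟪z₂ σ, EuclideanSpace.single 2 1⟫_ℝ) • (EuclideanSpace.single (2 : Fin 3) (1 : ℝ)) - z₂ σ)‖ ^ 2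
            + 1) ^ (3 / 2 : ℝ))⁻¹ •
          cross (deriv (fun u => (2 * ⟪z₂ u, EuclideanSpace.single 2 1⟫_ℝ) •
              (EuclideanSpace.single (2 : Fin 3) (1 : ℝ)) - z₂ u) σ)
            (z₂ t - ((2 * ⟪z₂ σ, EuclideanSpace.single 2 1⟫_ℝ) • (EuclideanSpace.single (2 : Fin 3) (1 : ℝ)) - z₂ σ)))‖
      ≤ 36 * δ * Real.sqrt Γ := by
  have hG : 0 < Real.sqrt Γ := Real.sqrt_pos.2 hΓ
  have hG2 : Real.sqrt Γ ^ 2 = Γ := Real.sq_sqrt hΓ.le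
  have hz₁d : Differentiable ℝ z₁ := hz₁.differentiable one_ne_zero
  have hz₂d : Differentiable ℝ z₂ := hz₂.differentiable one_ne_zero
  have hθ4 : θ ≤ 1 / 4 := by linarith only [hθ1]
  have hc : 0 < 1 - 2 * θ := by linarith only [hθ1]
  have hc' : 0 < 1 - 4 * θ := by linarith only [hθ1]
  -- the rotation as a continuous linear map and the two partner curves
  set e₃ : EuclideanSpace ℝ (Fin 3) := EuclideanSpace.single (2 : Fin 3) (1 : ℝ) with he₃
  set L : EuclideanSpace ℝ (Fin 3) →L[ℝ] EuclideanSpace ℝ (Fin 3) :=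
    (2 : ℝ) • (innerSL ℝ e₃).smulRight e₃ - ContinuousLinearMap.id ℝ (EuclideanSpace ℝ (Fin 3)) with hLdef
  have hL : ∀ y, L y = (2 * ⟪y, e₃⟫_ℝ) • e₃ - y := fun y => by
    simp [hLdef, smul_smul, real_inner_comm]
  set X₁ : ℝ → EuclideanSpace ℝ (Fin 3) := fun u => (2 * ⟪z₁ u, e₃⟫_ℝ) • e₃ - z₁ u with hX₁def
  set X₂ : ℝ → EuclideanSpace ℝ (Fin 3) := fun u => (2 * ⟪z₂ u, e₃⟫_ℝ) • e₃ - z₂ u with hX₂def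
  have hX₁L : X₁ = fun u => L (z₁ u) := by funext u; rw [hX₁def, hL]
  have hX₂L : X₂ = fun u => L (z₂ u) := by funext u; rw [hX₂def, hL]
  have hX₁c : ContDiff ℝ 1 X₁ := by rw [hX₁L]; exact L.contDiff.comp hz₁
  have hX₂c : ContDiff ℝ 1 X₂ := by rw [hX₂L]; exact L.contDiff.comp hz₂
  have hX₁d : ∀ u, deriv X₁ u = L (deriv z₁ u) := fun u => by
    rw [hX₁L]; exact (L.hasFDerivAt.comp_hasDerivAt u (hz₁d u).hasDerivAt).deriv
  have hX₂d : ∀ u, deriv X₂ u = L (deriv z₂ u) := fun u => by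
    rw [hX₂L]; exact (L.hasFDerivAt.comp_hasDerivAt u (hz₂d u).hasDerivAt).deriv
  have hdX₁ : ∀ u, ‖deriv X₁ u‖ ≤ 1 := fun u => by rw [hX₁d u, hL, norm_rotPi, hunit₁ u]
  have hdX₂ : ∀ u, ‖deriv X₂ u‖ ≤ 1 := fun u => by rw [hX₂d u, hL, norm_rotPi, hunit₂ u]
  have hgrow₁ : ∀ u, (1 - θ) * |u| - 0 ≤ ‖X₁ u‖ := fun u => by
    rw [sub_zero, hX₁def]; dsimp only; rw [norm_rotPi]; exact arc_norm_ge hΓ.le hz₁d hz₁0 hθ₁ u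
  have hgrow₂ : ∀ u, (1 - θ) * |u| - 0 ≤ ‖X₂ u‖ := fun u => by
    rw [sub_zero, hX₂def]; dsimp only; rw [norm_rotPi]; exact arc_norm_ge hΓ.le hz₂d hz₂0 hθ₂ u
  -- closeness of the two partner curves (pivot form at `0`)
  have htan : ∀ u, ‖deriv X₁ u - deriv X₂ u‖ ≤ δ := fun u => by
    rw [hX₁d u, hX₂d u, hL, hL, rotPi_sub_norm]; exact hδ₁₂ u
  have hpos : ∀ u, ‖X₁ u - X₂ u‖ ≤ δ * |u - 0| := fun u => by
    rw [sub_zero, hX₁def, hX₂def]; dsimp only; rw [rotPi_sub_norm]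
    exact curves_sub_le hz₁d hz₂d (hz₁0.trans hz₂0.symm) hδ₁₂ u
  -- distances from `z₁ t`
  have hD : 0 < (1 - 2 * θ) * (2 * Real.sqrt Γ / 5) := mul_pos hc (by positivity)
  have hsep₁ := fun u => nearStraight_sep_rot₂ hΓ hθ0 hθ4 hz₁d hz₁d hz₁0 hz₁0 hθ₁ hθ₁ t u
  have hsep₁₂ := fun u => nearStraight_sep_rot₂ hΓ hθ0 hθ4 hz₁d hz₂d hz₁0 hz₂0 hθ₁ hθ₂ t u
  have hfar : ∀ u, (1 - 2 * θ) * (2 * Real.sqrt Γ / 5) ≤ ‖z₁ t - X₁ u‖ := fun u => (hsep₁ u).2.1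
  have hfar' : ∀ u, (1 - 2 * θ) * (2 * Real.sqrt Γ / 5) ≤ ‖z₁ t - X₂ u‖ := fun u => (hsep₁₂ u).2.1
  have hesc : ∀ u, (1 - 2 * θ) * |u - 0| - 0 ≤ ‖z₁ t - X₁ u‖ := fun u => by
    rw [sub_zero, sub_zero]; exact (hsep₁ u).2.2.1
  have hesc' : ∀ u, (1 - 2 * θ) * |u - 0| - 0 ≤ ‖z₁ t - X₂ u‖ := fun u => by
    rw [sub_zero, sub_zero]; exact (hsep₁₂ u).2.2.1
  /- Term A: the two partner curves seen from `z₁ t` -/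
  have hA := biotSavart_curveLipschitz (e := 1) (u₀ := 0) (y := z₁ t) one_ne_zero (by linarith : 0 < 1 - θ)
    hX₁c hdX₁ hgrow₁ hX₂c hdX₂ hgrow₂ hδ htan hpos hc hD le_rfl hfar hfar' hesc hesc'
  simp only [one_pow, add_zero] at hA
  have hAnum := termA_bound' hΓ hθ1 hδ
  /- Term C: the field of `R_π ∘ z₂` at `z₁ t` versus at `z₂ t` (mean value on a ball around `z₂ t`) -/
  set N₁ : ℝ := Real.sqrt (4 * Γ / 25 + t ^ 2) with hN₁def
  have hN₁0 : 0 ≤ N₁ := Real.sqrt_nonneg _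
  have hN₁sq : N₁ ^ 2 = 4 * Γ / 25 + t ^ 2 := Real.sq_sqrt (by positivity)
  have hN₁G : 2 * Real.sqrt Γ / 5 ≤ N₁ := by
    rw [hN₁def, show 2 * Real.sqrt Γ / 5 = Real.sqrt ((2 * Real.sqrt Γ / 5) ^ 2) by rw [Real.sqrt_sq (by positivity)]]
    exact Real.sqrt_le_sqrt (by nlinarith only [hG2, sq_nonneg t])
  have hDt : 0 < (1 - 4 * θ) * N₁ := mul_pos hc' (lt_of_lt_of_le (by positivity) hN₁G)
  -- the two evaluation points are `2θ|t|`-close (independently of `δ`)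
  have h2θ : ∀ u, ‖deriv z₁ u - deriv z₂ u‖ ≤ 2 * θ := fun u => by
    have h := norm_sub_le (deriv z₁ u - WithLp.toLp 2 ![0, (Real.sqrt 2)⁻¹, (Real.sqrt 2)⁻¹])
      (deriv z₂ u - WithLp.toLp 2 ![0, (Real.sqrt 2)⁻¹, (Real.sqrt 2)⁻¹])
    have e1 : deriv z₁ u - WithLp.toLp 2 ![0, (Real.sqrt 2)⁻¹, (Real.sqrt 2)⁻¹] -
        (deriv z₂ u - WithLp.toLp 2 ![0, (Real.sqrt 2)⁻¹, (Real.sqrt 2)⁻¹]) = deriv z₁ u - deriv z₂ u := by abel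
    rw [e1] at h
    linarith only [h, hθ₁ u, hθ₂ u]
  have hdist2θ : ‖z₁ t - z₂ t‖ ≤ 2 * θ * |t| := curves_sub_le hz₁d hz₂d (hz₁0.trans hz₂0.symm) h2θ t
  have hdistδ : ‖z₁ t - z₂ t‖ ≤ δ * |t| := curves_sub_le hz₁d hz₂d (hz₁0.trans hz₂0.symm) hδ₁₂ t
  -- the field of `X₂` and its gradient bound on the ball
  set F₂ : EuclideanSpace ℝ (Fin 3) → EuclideanSpace ℝ (Fin 3) := fun y => ∫ u : ℝ,
    ((‖y - X₂ u‖ ^ 2 + 1) ^ (3 / 2 : ℝ))⁻¹ • cross (deriv X₂ u) (y - X₂ u) with hF₂def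
  have hF₂d : Differentiable ℝ F₂ := by
    have h := stub_biotSavartDifferentiable 1 (1 - θ) 0 X₂ one_ne_zero (by linarith) hX₂c hdX₂ hgrow₂
    simp only [one_pow] at h
    exact h
  have hbound : ∀ w ∈ Metric.closedBall (z₂ t) (2 * θ * |t|), ‖fderiv ℝ F₂ w‖ ≤
      8 * Real.pi * ((1 - 4 * θ) * N₁ + 0) / ((1 - 4 * θ) * ((1 - 4 * θ) * N₁) ^ 3) := by
    intro w hw
    rw [Metric.mem_closedBall, dist_eq_norm] at hw
    have hsep₂ := fun u => nearStraight_sep_rot₂ hΓ hθ0 hθ4 hz₂d hz₂d hz₂0 hz₂0 hθ₂ hθ₂ t u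
    have hM : ∀ u, N₁ ≤ Real.sqrt (4 * Γ / 25 + t ^ 2 + u ^ 2) ∧ |t| ≤ Real.sqrt (4 * Γ / 25 + t ^ 2 + u ^ 2) ∧
        |u| ≤ Real.sqrt (4 * Γ / 25 + t ^ 2 + u ^ 2) := fun u => by
      refine ⟨Real.sqrt_le_sqrt (by linarith only [sq_nonneg u]), ?_, ?_⟩
      · rw [← Real.sqrt_sq_eq_abs]; exact Real.sqrt_le_sqrt (by linarith only [sq_nonneg u, hΓ])
      · rw [← Real.sqrt_sq_eq_abs]; exact Real.sqrt_le_sqrt (by linarith only [sq_nonneg t, hΓ])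
    have hwX : ∀ u, (1 - 4 * θ) * Real.sqrt (4 * Γ / 25 + t ^ 2 + u ^ 2) ≤ ‖w - X₂ u‖ := fun u => by
      obtain ⟨-, hMt, -⟩ := hM u
      have h1 := (hsep₂ u).1
      have htri : ‖z₂ t - X₂ u‖ - ‖w - z₂ t‖ ≤ ‖w - X₂ u‖ := by
        have := norm_sub_le_norm_sub_add_norm_sub (z₂ t) w (X₂ u)
        rw [norm_sub_rev (z₂ t) w] at this; linarith only [this]
      have hp := mul_le_mul_of_nonneg_left hMt (by linarith only [hθ0] : 0 ≤ 2 * θ)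
      linarith only [h1, htri, hw, hp]
    have hfar_w : ∀ u, (1 - 4 * θ) * N₁ ≤ ‖w - X₂ u‖ := fun u =>
      (mul_le_mul_of_nonneg_left (hM u).1 hc'.le).trans (hwX u)
    have hesc_w : ∀ u, (1 - 4 * θ) * |u - 0| - 0 ≤ ‖w - X₂ u‖ := fun u => by
      rw [sub_zero, sub_zero]; exact (mul_le_mul_of_nonneg_left (hM u).2.2 hc'.le).trans (hwX u)
    have h := biotSavart_fderiv_norm_le (e := 1) (u₀ := 0) (A := 0) one_ne_zero (by linarith : 0 < 1 - θ)
      hX₂c hdX₂ hgrow₂ hc' hDt le_rfl hfar_w hesc_w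
    simp only [one_pow] at h
    exact h
  have hMV := Convex.norm_image_sub_le_of_norm_fderiv_le (f := F₂) (fun w _ => hF₂d w) hbound
    (convex_closedBall _ _) (Metric.mem_closedBall_self (by positivity))
    (by rw [Metric.mem_closedBall, dist_eq_norm]; exact hdist2θ)
  have hCnum := termC_bound hΓ hθ1 hδ t hN₁sq hN₁0
  /- assemble -/
  have hsplit : (Γ * 4 / (4 * Real.pi)) • (∫ σ : ℝ, ((‖z₁ t - X₁ σ‖ ^ 2 + 1) ^ (3 / 2 : ℝ))⁻¹ •
        cross (deriv X₁ σ) (z₁ t - X₁ σ)) - (Γ * 4 / (4 * Real.pi)) • F₂ (z₂ t) =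
      (Γ * 4 / (4 * Real.pi)) • ((∫ σ : ℝ, ((‖z₁ t - X₁ σ‖ ^ 2 + 1) ^ (3 / 2 : ℝ))⁻¹ •
        cross (deriv X₁ σ) (z₁ t - X₁ σ)) - F₂ (z₁ t)) + (Γ * 4 / (4 * Real.pi)) • (F₂ (z₁ t) - F₂ (z₂ t)) := by
    rw [smul_sub, smul_sub]; abel
  have hΓπ : 0 < Γ * 4 / (4 * Real.pi) := by positivity
  show ‖(Γ * 4 / (4 * Real.pi)) • (∫ σ : ℝ, ((‖z₁ t - X₁ σ‖ ^ 2 + 1) ^ (3 / 2 : ℝ))⁻¹ •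
        cross (deriv X₁ σ) (z₁ t - X₁ σ)) - (Γ * 4 / (4 * Real.pi)) • F₂ (z₂ t)‖ ≤ 36 * δ * Real.sqrt Γ
  rw [hsplit]
  have h1 : ‖(Γ * 4 / (4 * Real.pi)) • ((∫ σ : ℝ, ((‖z₁ t - X₁ σ‖ ^ 2 + 1) ^ (3 / 2 : ℝ))⁻¹ •
        cross (deriv X₁ σ) (z₁ t - X₁ σ)) - F₂ (z₁ t))‖ ≤ 51 / 2 * δ * Real.sqrt Γ := by
    rw [norm_smul, Real.norm_eq_abs, abs_of_pos hΓπ]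
    exact (mul_le_mul_of_nonneg_left hA hΓπ.le).trans hAnum
  have h2 : ‖(Γ * 4 / (4 * Real.pi)) • (F₂ (z₁ t) - F₂ (z₂ t))‖ ≤ 21 / 2 * δ * Real.sqrt Γ := by
    rw [norm_smul, Real.norm_eq_abs, abs_of_pos hΓπ]
    have hK0 : 0 ≤ 8 * Real.pi * ((1 - 4 * θ) * N₁ + 0) / ((1 - 4 * θ) * ((1 - 4 * θ) * N₁) ^ 3) := by positivity
    have h3 : ‖F₂ (z₁ t) - F₂ (z₂ t)‖ ≤
        8 * Real.pi * ((1 - 4 * θ) * N₁ + 0) / ((1 - 4 * θ) * ((1 - 4 * θ) * N₁) ^ 3) * (δ * |t|) :=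
      hMV.trans (mul_le_mul_of_nonneg_left hdistδ hK0)
    calc Γ * 4 / (4 * Real.pi) * ‖F₂ (z₁ t) - F₂ (z₂ t)‖
        ≤ Γ * 4 / (4 * Real.pi) * (8 * Real.pi * ((1 - 4 * θ) * N₁ + 0) / ((1 - 4 * θ) * ((1 - 4 * θ) * N₁) ^ 3) *
            (δ * |t|)) := mul_le_mul_of_nonneg_left h3 hΓπ.le
      _ = Γ * 4 / (4 * Real.pi) * (8 * Real.pi * ((1 - 4 * θ) * N₁ + 0) / ((1 - 4 * θ) * ((1 - 4 * θ) * N₁) ^ 3)) *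
            (δ * |t|) := by ring
      _ ≤ 21 / 2 * δ * Real.sqrt Γ := hCnum
  calc _ ≤ ‖(Γ * 4 / (4 * Real.pi)) • ((∫ σ : ℝ, ((‖z₁ t - X₁ σ‖ ^ 2 + 1) ^ (3 / 2 : ℝ))⁻¹ •
          cross (deriv X₁ σ) (z₁ t - X₁ σ)) - F₂ (z₁ t))‖ + ‖(Γ * 4 / (4 * Real.pi)) • (F₂ (z₁ t) - F₂ (z₂ t))‖ :=
        norm_add_le _ _
    _ ≤ 51 / 2 * δ * Real.sqrt Γ + 21 / 2 * δ * Real.sqrt Γ := add_le_add h1 h2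
    _ = 36 * δ * Real.sqrt Γ := by ring

end SelectionBoxRJRung

end Summit.NavierStokesRegularity.NavierStokesRegularity.Theorems
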